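import Literature.AlgebraicGeometry.ModuliOfAbelianVarieties.SiegelFineModuliSchemeLevelGroupAction
import Literature.AlgebraicGeometry.AbelianSchemes.LevelStructureTwistPrincipalLevelLocallyConstant
import Literature.AlgebraicGeometry.AbelianSchemes.PolarizedAbelianSchemeWithLevelBaseChange
import HarnessLib

/-!
# The classifying maps of two refinements of one level structure agree after every morphism killed by the twist
# operators of `K_δ(N₀)` — the coequalising step of `A_{g,δ,N} → A_{g,δ,N}/Γ` ([MFK94] Ch. 7 §3; [Deligne 1971] 4.16)

Topic `AlgebraicGeometry/ModuliOfAbelianVarieties`; namespace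
`Literature.AlgebraicGeometry.ModuliOfAbelianVarieties.SiegelFineModuliScheme`.  THEOREMS ONLY (no definition, no named
fact, no instance, no notation, no `sorry`; net Literature debt 0).  Cell hodgecm-mathlib (D-0151), F-DAG leaf F-10 (b)
«`classify` for the quotient `M/Γ`», brick (b2) CORE.  [MumfordFogartyKirwan1994] Ch. 7 §3 (remark after Thm. 7.9,
p. 139, and the mechanism of Thm. 7.10's proof pp. 140–142): the finite group `Γ = Γ_{N₀}^{(d)}` acts on the functor
`𝒜_{g,d,N}`, `N = N₀ d`, «hence on `A_{g,d,N}`», and `A_{g,d,N₀}` is recovered as the quotient; [Deligne1971TravauxShimura]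
4.16: `_{K}M_ℂ = _{K_n}M / (K/K_n)`.  To CLASSIFY a level-`N₀` triple through the quotient one refines its level
structure to level `N` locally (over a cover `T′ → T`), classifies on `T′`, and must check that on the kernel pair the
two classifying maps agree after `p : M → M/Γ`.  This file proves the heart of that check in the abstract form the
descent step consumes: for a triple `P` over `T` and a second symplectic-liftable level-`N` structure `η₂` on `P.A`
with the SAME level-`N₀` reduction, and ANY morphism `p : M → Q` killed by the twist operators `T_γ̄` of the reductions
`γ̄` of the `γ ∈ K_δ(N₀)` (★ `SiegelFineModuliSchemeLevelGroupAction`: `classifyingMap_comp_classifyingMap_twist`,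
liftability ★ `isSymplecticLiftable_twist_of_mem_principalLevelSubgroup_one`), the classifying maps of `P` and of
`(P.A, P.pol, η₂)` agree after `p`.  Inputs: ★ (b1‴) `LevelStructureTwistPrincipalLevelLocallyConstant` (the open cover
on which `η₂ = P.level · γ̄_j`, `γ_j ∈ K_δ(N₀)`), ★ `PolarizedAbelianSchemeWithLevel.baseChange` /
`baseChange_isBaseChangeVia`, ★ `SiegelFineModuliScheme.classifyingMap_comp`, Mathlib `Scheme.Cover.hom_ext`.
HC_CM is proved only modulo the 7 printed citations until rung 0 closes; this file discharges none of them
(count-neutral capital).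

* `classifyingMap_left_comp_eq_of_changeLevel_eq` — THE COEQUALISING IDENTITY
  `(classifyingMap T P).left ≫ p = (classifyingMap T (P.A, P.pol, η₂)).left ≫ p`.

Mathlib searched (pin): `Scheme.Cover.hom_ext`, `Over.homMk`, `Over.comp_left`, the instance
`IsLocallyNoetherian (𝒰.X j)` for open covers (all used).

## References
* D. Mumford, J. Fogarty, F. Kirwan, *Geometric Invariant Theory*, 3rd ed. (1994), Ch. 7 §3 (pp. 139–140; Thm. 7.10's
  proof pp. 140–142). [MumfordFogartyKirwan1994]
* P. Deligne, *Travaux de Shimura*, Sém. Bourbaki 389 (1971), 4.12 (b) p. 149; 4.16 p. 150. [Deligne1971TravauxShimura]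
-/

noncomputable section

open CategoryTheory CategoryTheory.Limits AlgebraicGeometry

namespace Literature.AlgebraicGeometry.ModuliOfAbelianVarieties

open Literature.AlgebraicGeometry.Motives (SchemeOver)
open Literature.AlgebraicGeometry.AbelianSchemes (PolarizedAbelianSchemeWithLevel)
open Literature.AlgebraicGeometry.AbelianSchemes.AbelianSchemeOver
open Literature.NumberTheory.Adeles NumberField IsDedekindDomain

namespace SiegelFineModuliScheme

variable {g N : ℕ} {δ : Fin g → ℕ} (𝓜 : SiegelFineModuliScheme g N δ) [IsCommMonObj 𝓜.univ.A.X] [NeZero N]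

/-- Over a `ℚ`-scheme no positive integer vanishes in a residue field (the structure map `ℚ → κ(t)` read off
`Spec κ(t) → T → Spec ℚ` is a ring map out of a field). [folklore] -/
private theorem natCast_residueField_ne_zero (T : SchemeOver ℚ) (t : T.left) : (N : T.left.residueField t) ≠ 0 := by
  let φ : ℚ →+* T.left.residueField t := (Spec.preimage (T.left.fromSpecResidueField t ≫ T.hom)).hom
  rw [← map_natCast φ N]
  exact (map_ne_zero φ).mpr (Nat.cast_ne_zero.mpr (NeZero.ne N))

/-- **THE CLASSIFYING MAPS OF TWO SYMPLECTIC-LIFTABLE REFINEMENTS OF ONE LEVEL-`N₀` STRUCTURE AGREE AFTER EVERY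
MORPHISM KILLED BY THE TWIST OPERATORS OF `K_δ(N₀)`** — the coequalising heart of the level descent
`A_{g,δ,N} → A_{g,δ,N}/Γ`, `Γ = K_δ(N₀)/K_δ(N)` ([MumfordFogartyKirwan1994] Ch. 7 §3, remark after Thm. 7.9 p. 139 and
the mechanism of pp. 140–142: «`Γ` acts on `𝒜_{g,d,n}`, hence on `A_{g,d,n}`»; [Deligne1971TravauxShimura] 4.12 (b),
4.16: `_{K}M = _{K_n}M / (K/K_n)`).  Let `𝓜` be a fine moduli carrier at level `N = N₀ d`, `P` a triple over a locally
Noetherian `ℚ`-scheme `T` and `η₂` a second symplectic-liftable level-`N` structure on `P.A` with the SAME level-`N₀`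
reduction as `P.level`.  If `p : M → Q` satisfies `T_γ̄ ≫ p = p` for the twist operator `T_γ̄` (★
`classifyingMap_comp_classifyingMap_twist`) of the reduction `γ̄ ∈ GL_{2g}(ℤ/N)` of every `γ ∈ K_δ(N₀)`, then the
classifying maps of `P` and of `(P.A, P.pol, η₂)` agree after `p`.  Proof: by ★
`LevelStructure.exists_openCover_comp_left_eq_twist_of_changeLevel_eq` there is an open cover `𝒰` of `T` with
`γ_j ∈ K_δ(N₀)` and `η₂ = P.level · γ̄_j` on the `j`-th member; there the base change of `(P.A, P.pol, η₂)` is ALSO a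
pull-back of the twisted triple `P · γ̄_j`, so by ★ `classifyingMap_comp` (twice) and the naturality ★
`classifyingMap_comp_classifyingMap_twist` the two classifying maps differ by `T_{γ̄_j}` on the member; `p` kills the
difference, and the members cover (Mathlib `Scheme.Cover.hom_ext`).  The twisted structures are symplectic-liftable
by ★ `isSymplecticLiftable_twist_of_mem_principalLevelSubgroup_one` (`δ` a polarisation type, `0 < g`).
[cite: MumfordFogartyKirwan1994, Ch. 7 §3 (pp. 139–140)] [cite: Deligne1971TravauxShimura, 4.12 (b) p. 149 and 4.16 p. 150] -/
theorem classifyingMap_left_comp_eq_of_changeLevel_eq (hδ : IsPolarizationType δ) (hg : 0 < g) {N₀ d : ℕ}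
    [NeZero N₀] (hd : N = N₀ * d) (T : SchemeOver ℚ) [IsLocallyNoetherian T.left]
    (P : PolarizedAbelianSchemeWithLevel g N δ T.left) [IsCommMonObj P.A.X] (η₂ : P.A.LevelStructure g N)
    (h₂ : η₂.IsSymplecticLiftable P.pol δ)
    (hη : P.level.changeLevel N₀ d hd (NeZero.ne N) = η₂.changeLevel N₀ d hd (NeZero.ne N))
    {Q : Scheme} (p : 𝓜.M.left ⟶ Q)
    (hp : ∀ r : gspFinAdelic δ, r ∈ principalLevelSubgroup δ N₀ → ∀ GN : GL (Fin g ⊕ Fin g) (ZMod N),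
      (∀ (i j : Fin g ⊕ Fin g)
        (h : ((r : GL (Fin g ⊕ Fin g) finAdeleQ) : Matrix (Fin g ⊕ Fin g) (Fin g ⊕ Fin g) finAdeleQ) i j ∈
          FiniteAdeleRing.integralAdeles (𝓞 ℚ) ℚ),
        (GN : Matrix (Fin g ⊕ Fin g) (Fin g ⊕ Fin g) (ZMod N)) i j = integralAdeleResidue N ⟨_, h⟩) →
      ∀ hs : (𝓜.univ.level.twist GN).IsSymplecticLiftable 𝓜.univ.pol δ,
        (haveI := 𝓜.isLocallyNoetherian
         (𝓜.classifyingMap 𝓜.M ({ 𝓜.univ with level := 𝓜.univ.level.twist GN, symplectic := hs } :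
           PolarizedAbelianSchemeWithLevel g N δ 𝓜.M.left)).left) ≫ p = p) :
    (𝓜.classifyingMap T P).left ≫ p =
      (𝓜.classifyingMap T ({ P with level := η₂, symplectic := h₂ } :
        PolarizedAbelianSchemeWithLevel g N δ T.left)).left ≫ p := by
  haveI := 𝓜.isLocallyNoetherian
  -- the open cover of `T` on which `η₂ = P.level · γ̄_j`, `γ_j ∈ K_δ(N₀)`
  obtain ⟨𝒰, r, gm, hr, hgm, heq⟩ :=
    LevelStructure.exists_openCover_comp_left_eq_twist_of_changeLevel_eq P.level η₂
      (natCast_residueField_ne_zero (N := N) T) hd hη P.symplectic h₂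
  set P₂ : PolarizedAbelianSchemeWithLevel g N δ T.left := { P with level := η₂, symplectic := h₂ }
  refine Scheme.Cover.hom_ext 𝒰 _ _ fun j => ?_
  -- liftability of the twisted structures (universal and `P`)
  have h1j : r j ∈ principalLevelSubgroup δ 1 := principalLevelSubgroup_anti δ (one_dvd N₀) (hr j)
  have hsU : (𝓜.univ.level.twist (gm j)).IsSymplecticLiftable 𝓜.univ.pol δ :=
    isSymplecticLiftable_twist_of_mem_principalLevelSubgroup_one δ hδ hg h1j (gm j) (hgm j) 𝓜.univ.symplectic
  have hsP : (P.level.twist (gm j)).IsSymplecticLiftable P.pol δ :=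
    isSymplecticLiftable_twist_of_mem_principalLevelSubgroup_one δ hδ hg h1j (gm j) (hgm j) P.symplectic
  -- the member as a `ℚ`-scheme and the base change of `P₂` to it
  let Uj : SchemeOver ℚ := Over.mk (𝒰.f j ≫ T.hom)
  haveI : IsLocallyNoetherian Uj.left := inferInstanceAs (IsLocallyNoetherian (𝒰.X j))
  let x : Uj ⟶ T := Over.homMk (𝒰.f j) rfl
  have hx : x.left = 𝒰.f j := rfl
  let Pj : PolarizedAbelianSchemeWithLevel g N δ Uj.left := P₂.baseChange (𝒰.f j)
  have w1 := P₂.baseChange_isBaseChangeVia (𝒰.f j)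
  -- `Pj` is ALSO a pull-back of the twisted triple `P · γ̄_j` (the level clause moves by `heq j`)
  have w2 : Pj.IsBaseChangeVia ({ P with level := P.level.twist (gm j), symplectic := hsP } :
      PolarizedAbelianSchemeWithLevel g N δ T.left) (𝒰.f j) (pullback.fst P.A.X.hom (𝒰.f j))
      (pullback.fst P.D.hat.X.hom (𝒰.f j)) :=
    ⟨⟨w1.1.1, fun i => (w1.1.2 i).trans (heq j i)⟩, w1.2.1, w1.2.2.1, w1.2.2.2⟩
  have e1 : x ≫ 𝓜.classifyingMap T P₂ = 𝓜.classifyingMap Uj Pj := 𝓜.classifyingMap_comp x P₂ Pj w1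
  have e2 : x ≫ 𝓜.classifyingMap T ({ P with level := P.level.twist (gm j), symplectic := hsP } :
      PolarizedAbelianSchemeWithLevel g N δ T.left) = 𝓜.classifyingMap Uj Pj :=
    𝓜.classifyingMap_comp x _ Pj w2
  have e3 := 𝓜.classifyingMap_comp_classifyingMap_twist (gm j) hsU T P hsP
  -- assemble on the member
  have h12 : 𝒰.f j ≫ (𝓜.classifyingMap T P₂).left =
      𝒰.f j ≫ (𝓜.classifyingMap T ({ P with level := P.level.twist (gm j), symplectic := hsP } :
        PolarizedAbelianSchemeWithLevel g N δ T.left)).left := by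
    have h := congrArg (fun f => f.left) (e1.trans e2.symm)
    simp only [Over.comp_left, hx] at h
    exact h
  have e3' := congrArg (fun f => f.left) e3
  simp only [Over.comp_left] at e3'
  have e4 : 𝒰.f j ≫ (𝓜.classifyingMap T P₂).left =
      𝒰.f j ≫ (𝓜.classifyingMap T P).left ≫
        (𝓜.classifyingMap 𝓜.M ({ 𝓜.univ with level := 𝓜.univ.level.twist (gm j), symplectic := hsU } :
          PolarizedAbelianSchemeWithLevel g N δ 𝓜.M.left)).left := by
    rw [h12, ← e3']
  calc 𝒰.f j ≫ (𝓜.classifyingMap T P).left ≫ p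
      = 𝒰.f j ≫ (𝓜.classifyingMap T P).left ≫
          ((𝓜.classifyingMap 𝓜.M ({ 𝓜.univ with level := 𝓜.univ.level.twist (gm j), symplectic := hsU } :
            PolarizedAbelianSchemeWithLevel g N δ 𝓜.M.left)).left ≫ p) := by
          rw [hp (r j) (hr j) (gm j) (hgm j) hsU]
    _ = (𝒰.f j ≫ (𝓜.classifyingMap T P₂).left) ≫ p := by
          rw [e4]; simp only [Category.assoc]
    _ = 𝒰.f j ≫ (𝓜.classifyingMap T P₂).left ≫ p := Category.assoc _ _ _

end SiegelFineModuliScheme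

end Literature.AlgebraicGeometry.ModuliOfAbelianVarieties

end
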